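import Summits.ResolutionOfSingularities.ResolutionOfSingularities.Theorems.EquisingularLiftEquisingularLiftNatMarkedCharts
import Summits.ResolutionOfSingularities.ResolutionOfSingularities.Theorems.EquisingularLiftEquisingularLiftNatAffineTwoStepOrigin
import HarnessLib

/-!
# [OURS] THE MULTI-ROOT AFFINE TWO-STEP BRIDGE: one-step AT A MARKED POINT `T = λ` of a chart (translation `G_a(T + λ)`), and the packaged `hDsucc`
# clause at the origin of `Spec K[y]/(Φ + Ψ)` under MARKED second-order data (exceptional singular points anywhere on the exceptional divisor,
# e.g. the three `A₁` points over a `D₄` point) — bricks 4–5 of the multi-root level-1 bridge begun in ✓ …NatMarkedCharts (p836016)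
# (cruxes `Theses.EquisingularLift.EquisingularLiftNat` / `…NatThree` / `EquisingularLift`, stmt-ResolutionOfSingularities-20038 / -20148 / -15660)

[OURS · leafhand-res-equisingularlift-12 g0, 2026-08-31; cell `pub/decomp-res`] AI-produced, weaker than expert review; NOT a statement of any manuscript;
nothing here proves resolution of singularities in positive characteristic.  DEF-FREE helper; no `sorry`; standard axioms; ZERO named hypotheses.

* `OneStep.exists_translate_quotientEquiv` — for `λ : Fin (N+1) → K` and `H = G(T + λ)` (`aeval (T_i + λ_i) G = H`) a ring isomorphism
  `σ̄ : K[T]/(H) ≃ K[T]/(G)` (induced by the translation `T_i ↦ T_i − λ_i`) carrying the origin `(T̄)` to the marked point `(T_i − λ_i)‾`;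
* `OneStep.isMaximal_span_range_X_sub_C` — `(T_i − λ_i)_i` is a maximal ideal of `K[T]`;
* ★★ `OneStep.oneStepAt_chartMark` — the point `w` of the chart `(A/(f))[Ī/ȳ_a] ≅_χ K[T]/(G_a)` with ideal `χ((T_i − λ_i)‾)` is a CLOSED ONE-STEP point of
  the blow-up `Z` (through any open immersion `φ` of the chart into `Z`), as soon as the translate `G_a(T + λ) = Φ' + Ψ'` carries one-step data at the
  origin — ✓ `oneStepAt_chartOrigin` (p833512) applied to `σ̄ ≫ χ`;
* ★★★ `OneStep.twoStepAt_origin_marked` — `f = Φ + Ψ` with per-chart strict transforms `G_a`, finite mark sets `Λ a ⊆ K^{N+1}`, the MARKED Jacobian datum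
  «at every prime `P ∋ T_a, G_a` some `∂_jG_a ∉ P` or `T_i − λ_i ∈ P` for all `i`, for some `λ ∈ Λ a`», and for every mark `λ ∈ Λ a` lying on the strict
  transform (`G_a ∈ (T_i − λ_i)`) a second-order splitting of the translate `G_a(T + λ) = Φ' + Ψ'` with one-step data: then the origin `y₀` is a TWO-STEP
  point — for every blow-up `τ : Z → Spec K[y]/(f)` along `vanishingIdeal {y₀}` a finite `S' ⊆ Z` of closed ONE-STEP points over `y₀` off which `Z` is regular
  over `y₀` (VERBATIM the `hDsucc` clause / the hypothesis `htwo` of ✓ `PointChain.chain_of_twoStepPoints`).  ✓ `OneStep.twoStepAt_origin` (p833573) is the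
  case `Λ a = {0}`.

Remaining for `D₄`-type vertices (next hand, S each): the transports ✓ `twoStepAt_of_affineChart` / ✓ `twoStepAt_vertex` with the marked data in place of
`hjac`/`hsec` (their proofs verbatim, last line ↦ `twoStepAt_origin_marked`), and the polynomial `D₄` datum (`x² + y³ + z³`-type: three marks in one chart).
Honest label: closes no registered stub.

References: [StacksProject, Tags 0804, 080E, 00E0]; [GortzWedhorn2020, Prop. 13.91]; through the cited tree files.
-/

set_option linter.dupNamespace false -- mandated namespace `Summit.<Summit>.<Problem>` of this single-conjunct summit

noncomputable section

open CategoryTheory CategoryTheory.Limits AlgebraicGeometry TopologicalSpace Topology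
open MvPolynomial
open Literature.AlgebraicGeometry.Resolution
open AlgebraicGeometry.Scheme.IdealSheafData
open Summit.ResolutionOfSingularities.ResolutionOfSingularities.Cruxes.EquisingularLiftNat.Sections.ND

namespace Summit.ResolutionOfSingularities.ResolutionOfSingularities.Cruxes.EquisingularLiftNat.Sections

namespace OneStep

variable (K : Type) [Field K] {N : ℕ}

/-- **The translation automorphism `T_i ↦ T_i − λ_i` of `K[T]`** (inverse `T_i ↦ T_i + λ_i`). [folklore] -/
theorem exists_translate_algEquiv (lam : Fin (N + 1) → K) :
    ∃ s : MvPolynomial (Fin (N + 1)) K ≃ₐ[K] MvPolynomial (Fin (N + 1)) K,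
      (∀ i, s (X i) = X i - C (lam i)) ∧ ∀ q, s (aeval (fun i => X i + C (lam i)) q) = q := by
  let f : Fin (N + 1) → MvPolynomial (Fin (N + 1)) K := fun i => X i - C (lam i)
  let g : Fin (N + 1) → MvPolynomial (Fin (N + 1)) K := fun i => X i + C (lam i)
  have h1 : (aeval f).comp (aeval g) = AlgHom.id K (MvPolynomial (Fin (N + 1)) K) := by
    refine MvPolynomial.algHom_ext fun i => ?_
    simp [f, g]
  have h2 : (aeval g).comp (aeval f) = AlgHom.id K (MvPolynomial (Fin (N + 1)) K) := by
    refine MvPolynomial.algHom_ext fun i => ?_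
    simp [f, g]
  refine ⟨AlgEquiv.ofAlgHom (aeval f) (aeval g) h1 h2, fun i => ?_, fun q => ?_⟩
  · change aeval f (X i) = _
    rw [aeval_X]
  · change ((aeval f).comp (aeval g)) q = q
    rw [h1]; rfl

/-- **`(T_i − λ_i)_i` is a maximal ideal of `K[T]`** (the translate of `(T)`). [folklore] -/
theorem isMaximal_span_range_X_sub_C (lam : Fin (N + 1) → K) :
    (Ideal.span (Set.range fun i : Fin (N + 1) => (X i - C (lam i) : MvPolynomial (Fin (N + 1)) K))).IsMaximal := by
  obtain ⟨s, hsX, -⟩ := exists_translate_algEquiv K lam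
  haveI hT := isMaximal_span_range_X' K (N := N)
  have hmap : Ideal.map s (Ideal.span (Set.range (X : Fin (N + 1) → MvPolynomial (Fin (N + 1)) K))) =
      Ideal.span (Set.range fun i : Fin (N + 1) => (X i - C (lam i) : MvPolynomial (Fin (N + 1)) K)) := by
    rw [Ideal.map_span, ← Set.range_comp]
    simp only [Function.comp_def, hsX]
  rw [← hmap]
  exact Ideal.map_isMaximal_of_equiv s (p := _)

/-- **The translation descends to `σ̄ : K[T]/(G(T + λ)) ≃ K[T]/(G)` and carries the origin `(T̄)` to the marked point `(T_i − λ_i)‾`.** [folklore] -/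
theorem exists_translate_quotientEquiv (lam : Fin (N + 1) → K) (G H : MvPolynomial (Fin (N + 1)) K)
    (hGH : aeval (fun i => X i + C (lam i)) G = H) :
    ∃ σ : (MvPolynomial (Fin (N + 1)) K ⧸ Ideal.span {H}) ≃+* (MvPolynomial (Fin (N + 1)) K ⧸ Ideal.span {G}),
      Ideal.map σ.toRingHom (Ideal.map (Ideal.Quotient.mk (Ideal.span {H})) (Ideal.span (Set.range (X : Fin (N + 1) → MvPolynomial (Fin (N + 1)) K)))) =
        Ideal.map (Ideal.Quotient.mk (Ideal.span {G})) (Ideal.span (Set.range fun i : Fin (N + 1) => (X i - C (lam i) : MvPolynomial (Fin (N + 1)) K))) := by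
  obtain ⟨s, hsX, hsg⟩ := exists_translate_algEquiv K lam
  have hsH : s H = G := by rw [← hGH]; exact hsg G
  have hIJ : Ideal.span {G} = Ideal.map s.toRingEquiv (Ideal.span {H}) := by
    rw [Ideal.map_span, Set.image_singleton]
    exact congrArg (fun b => Ideal.span {b}) hsH.symm
  refine ⟨Ideal.quotientEquiv (Ideal.span {H}) (Ideal.span {G}) s.toRingEquiv hIJ, ?_⟩
  have hcomp : (Ideal.quotientEquiv (Ideal.span {H}) (Ideal.span {G}) s.toRingEquiv hIJ).toRingHom.comp (Ideal.Quotient.mk (Ideal.span {H})) =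
      (Ideal.Quotient.mk (Ideal.span {G})).comp s.toRingEquiv.toRingHom :=
    RingHom.ext fun q => Ideal.quotientEquiv_mk (Ideal.span {H}) (Ideal.span {G}) s.toRingEquiv hIJ q
  have hsX' : Ideal.map s (Ideal.span (Set.range (X : Fin (N + 1) → MvPolynomial (Fin (N + 1)) K))) =
      Ideal.span (Set.range fun i : Fin (N + 1) => (X i - C (lam i) : MvPolynomial (Fin (N + 1)) K)) := by
    rw [Ideal.map_span, ← Set.range_comp]
    simp only [Function.comp_def, hsX]
  have hsX'' : Ideal.map s.toRingEquiv.toRingHom (Ideal.span (Set.range (X : Fin (N + 1) → MvPolynomial (Fin (N + 1)) K))) =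
      Ideal.span (Set.range fun i : Fin (N + 1) => (X i - C (lam i) : MvPolynomial (Fin (N + 1)) K)) := hsX'
  rw [Ideal.map_map, hcomp, ← Ideal.map_map, hsX'']

set_option maxHeartbeats 800000 in -- the chart algebra `blowupAlgebra` is a subalgebra of a localisation: slow instance unification (as in …NatAffineTwoStepOrigin)
/-- ★★ **A MARKED POINT OF THE CHART IS A ONE-STEP POINT OF THE BLOW-UP** when the TRANSLATE of the chart's strict transform carries one-step data at the
origin: `G_a(T + λ) = Φ' + Ψ'` with `Φ' ≠ 0` a form of degree `μ' ≥ 1`, `Ψ' ∈ (T)^{μ'+1}` and (hone').  The point `w` with ideal `χ((T_i − λ_i)‾)` is then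
CLOSED in `Z` (through the open immersion `φ`) and every blow-up of `Z` at it is regular over it — ✓ `oneStepAt_chartOrigin` for the composite isomorphism
`K[T]/(Φ' + Ψ') ≅_σ̄ K[T]/(G_a) ≅_χ (A/(f))[Ī/ȳ_a]` (✓ `exists_translate_quotientEquiv`). [OURS] [cite: GortzWedhorn2020, Prop. 13.91, (13.19)] -/
theorem oneStepAt_chartMark (Φ Ψ : MvPolynomial (Fin (N + 1)) K) (a : Fin (N + 1)) (Ga : MvPolynomial (Fin (N + 1)) K)
    (lam : Fin (N + 1) → K) (Φ' Ψ' : MvPolynomial (Fin (N + 1)) K) {μ' : ℕ} (hμ' : 1 ≤ μ')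
    (hΦ' : Φ'.IsHomogeneous μ') (hΦ'0 : Φ' ≠ 0)
    (hΨ' : Ψ' ∈ Ideal.span (Set.range (X : Fin (N + 1) → MvPolynomial (Fin (N + 1)) K)) ^ (μ' + 1))
    (hGa : aeval (fun i => X i + C (lam i)) Ga = Φ' + Ψ')
    (hone' : ∀ b : Fin (N + 1), ∃ G' : MvPolynomial (Fin (N + 1)) K,
      aeval (fun j => X b * Function.update (X : Fin (N + 1) → MvPolynomial (Fin (N + 1)) K) b 1 j) (Φ' + Ψ') = X b ^ μ' * G' ∧
      ∀ P : Ideal (MvPolynomial (Fin (N + 1)) K), P.IsPrime → (X b : MvPolynomial (Fin (N + 1)) K) ∈ P → G' ∈ P → ∃ j, pderiv j G' ∉ P)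
    (χ : (MvPolynomial (Fin (N + 1)) K ⧸ Ideal.span {Ga}) ≃+* blowupAlgebra ((Ideal.span (Set.range (X : Fin (N + 1) → MvPolynomial (Fin (N + 1)) K))).map
          (Ideal.Quotient.mk (Ideal.span {Φ + Ψ}))) (Ideal.Quotient.mk (Ideal.span {Φ + Ψ}) (X a)))
    {Z : Scheme.{0}} (ρ : Z ⟶ Spec (CommRingCat.of (MvPolynomial (Fin (N + 1)) K ⧸ Ideal.span {Φ + Ψ}))) [LocallyOfFiniteType ρ]
    (φ : Spec (CommRingCat.of (blowupAlgebra ((Ideal.span (Set.range (X : Fin (N + 1) → MvPolynomial (Fin (N + 1)) K))).map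
          (Ideal.Quotient.mk (Ideal.span {Φ + Ψ}))) (Ideal.Quotient.mk (Ideal.span {Φ + Ψ}) (X a)))) ⟶ Z) [IsOpenImmersion φ] (w : Spec (CommRingCat.of (blowupAlgebra ((Ideal.span (Set.range (X : Fin (N + 1) → MvPolynomial (Fin (N + 1)) K))).map
          (Ideal.Quotient.mk (Ideal.span {Φ + Ψ}))) (Ideal.Quotient.mk (Ideal.span {Φ + Ψ}) (X a)))))
    (hw : w.asIdeal = Ideal.map χ.toRingHom (Ideal.map (Ideal.Quotient.mk (Ideal.span {Ga}))
      (Ideal.span (Set.range fun i : Fin (N + 1) => (X i - C (lam i) : MvPolynomial (Fin (N + 1)) K))))) :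
    ∃ hz : IsClosed ({φ w} : Set Z), ∀ (Z' : Scheme.{0}) (τ' : Z' ⟶ Z), IsBlowup τ' (vanishingIdeal ⟨{φ w}, hz⟩) →
      ∀ z' : Z', τ' z' = φ w → IsRegularLocalRing (Z'.presheaf.stalk z') := by
  obtain ⟨σ, hσ⟩ := exists_translate_quotientEquiv K lam Ga (Φ' + Ψ') hGa
  have hw' : w.asIdeal = Ideal.map (σ.trans χ).toRingHom (Ideal.map (Ideal.Quotient.mk (Ideal.span {Φ' + Ψ'}))
      (Ideal.span (Set.range (X : Fin (N + 1) → MvPolynomial (Fin (N + 1)) K)))) := by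
    rw [hw, ← hσ, Ideal.map_map]
    rfl
  exact oneStepAt_chartOrigin K Φ Ψ a Φ' Ψ' hμ' hΦ' hΦ'0 hΨ' hone' (σ.trans χ) ρ φ w hw'

/-- **A mark on the strict transform**: if the point with ideal `χ(𝔪̄)` is a genuine point (its ideal is proper) then `G_a ∈ 𝔪` — otherwise `𝔪 + (G_a) = K[T]`
and `𝔪̄ = K[T]/(G_a)`. [folklore] -/
theorem mem_of_mark_ne_top (Ga : MvPolynomial (Fin (N + 1)) K) (𝔪 : Ideal (MvPolynomial (Fin (N + 1)) K)) (h𝔪 : 𝔪.IsMaximal)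
    {S : Type} [CommRing S] (χ : (MvPolynomial (Fin (N + 1)) K ⧸ Ideal.span {Ga}) ≃+* S) (Q : Ideal S) (hQ : Q ≠ ⊤)
    (hQ𝔪 : Q = Ideal.map χ.toRingHom (Ideal.map (Ideal.Quotient.mk (Ideal.span {Ga})) 𝔪)) : Ga ∈ 𝔪 := by
  by_contra hGa
  obtain ⟨y, i, hi, hyi⟩ := h𝔪.exists_inv hGa
  apply hQ
  rw [hQ𝔪, Ideal.eq_top_iff_one]
  have h1 : (1 : MvPolynomial (Fin (N + 1)) K ⧸ Ideal.span {Ga}) ∈ Ideal.map (Ideal.Quotient.mk (Ideal.span {Ga})) 𝔪 := by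
    have e : Ideal.Quotient.mk (Ideal.span {Ga}) i = 1 := by
      have h := congrArg (Ideal.Quotient.mk (Ideal.span {Ga})) hyi
      rwa [map_add, map_mul, Ideal.Quotient.eq_zero_iff_mem.mpr (Ideal.mem_span_singleton_self Ga), mul_zero, zero_add,
        map_one] at h
    rw [← e]
    exact Ideal.mem_map_of_mem _ hi
  simpa using Ideal.mem_map_of_mem χ.toRingHom h1

set_option maxHeartbeats 800000 in -- the chart algebra `blowupAlgebra` is a subalgebra of a localisation: slow instance unification (as in …NatAffineTwoStepPackage)
/-- ★★★ **THE ORIGIN OF AN AFFINE HYPERSURFACE WITH MARKED SECOND-ORDER DATA IS A TWO-STEP POINT** (towers' `hDsucc` clause, level `1`; multi-root form of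
✓ `OneStep.twoStepAt_origin`, which is the case `Λ a = {0}`).  Marks: finite sets `Λ a ⊆ K^{N+1}` per chart; the MARKED Jacobian datum «at every prime
`P ∋ T_a, G_a` some `∂_jG_a ∉ P` or all `T_i − λ_i ∈ P` for some `λ ∈ Λ a`»; for every mark on the strict transform a second-order splitting of the translate
`G_a(T + λ) = Φ' + Ψ'` with one-step data. [OURS] [cite: StacksProject, Tag 0804] [cite: GortzWedhorn2020, Prop. 13.91] -/
theorem twoStepAt_origin_marked (Φ Ψ : MvPolynomial (Fin (N + 1)) K) {μ : ℕ} (hμ : 1 ≤ μ)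
    (hΦ : Φ.IsHomogeneous μ) (hΦ0 : Φ ≠ 0)
    (hΨ : Ψ ∈ Ideal.span (Set.range (X : Fin (N + 1) → MvPolynomial (Fin (N + 1)) K)) ^ (μ + 1))
    (G : Fin (N + 1) → MvPolynomial (Fin (N + 1)) K)
    (hG : ∀ a, aeval (fun j => X a * Function.update (X : Fin (N + 1) → MvPolynomial (Fin (N + 1)) K) a 1 j) (Φ + Ψ) = X a ^ μ * G a)
    (Λ : Fin (N + 1) → Finset (Fin (N + 1) → K))
    (hjac : ∀ a, ∀ P : Ideal (MvPolynomial (Fin (N + 1)) K), P.IsPrime → (X a : MvPolynomial (Fin (N + 1)) K) ∈ P → G a ∈ P →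
      (∃ j, pderiv j (G a) ∉ P) ∨ ∃ lam ∈ Λ a, ∀ i, (X i - C (lam i) : MvPolynomial (Fin (N + 1)) K) ∈ P)
    (hsec : ∀ a, ∀ lam ∈ Λ a, G a ∈ Ideal.span (Set.range fun i : Fin (N + 1) => (X i - C (lam i) : MvPolynomial (Fin (N + 1)) K)) →
      ∃ (μ' : ℕ) (Φ' Ψ' : MvPolynomial (Fin (N + 1)) K), 1 ≤ μ' ∧ Φ'.IsHomogeneous μ' ∧ Φ' ≠ 0 ∧
        Ψ' ∈ Ideal.span (Set.range (X : Fin (N + 1) → MvPolynomial (Fin (N + 1)) K)) ^ (μ' + 1) ∧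
        aeval (fun i => X i + C (lam i)) (G a) = Φ' + Ψ' ∧
        ∀ b : Fin (N + 1), ∃ G' : MvPolynomial (Fin (N + 1)) K,
          aeval (fun j => X b * Function.update (X : Fin (N + 1) → MvPolynomial (Fin (N + 1)) K) b 1 j) (Φ' + Ψ') = X b ^ μ' * G' ∧
          ∀ P : Ideal (MvPolynomial (Fin (N + 1)) K), P.IsPrime → (X b : MvPolynomial (Fin (N + 1)) K) ∈ P → G' ∈ P → ∃ j, pderiv j G' ∉ P)
    (y₀ : Spec (CommRingCat.of (MvPolynomial (Fin (N + 1)) K ⧸ Ideal.span {Φ + Ψ})))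
    (hy₀ : y₀.asIdeal = Ideal.map (Ideal.Quotient.mk (Ideal.span {Φ + Ψ}))
      (Ideal.span (Set.range (X : Fin (N + 1) → MvPolynomial (Fin (N + 1)) K)))) :
    ∀ (hy : IsClosed ({y₀} : Set (Spec (CommRingCat.of (MvPolynomial (Fin (N + 1)) K ⧸ Ideal.span {Φ + Ψ})))))
      (Z : Scheme.{0}) (τ : Z ⟶ Spec (CommRingCat.of (MvPolynomial (Fin (N + 1)) K ⧸ Ideal.span {Φ + Ψ}))),
      IsBlowup τ (vanishingIdeal ⟨{y₀}, hy⟩) →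
      ∃ S' : Finset Z, (∀ z : Z, τ z = y₀ → z ∉ S' → IsRegularLocalRing (Z.presheaf.stalk z)) ∧
        ∀ z ∈ S', τ z = y₀ ∧ ∃ hz : IsClosed ({z} : Set Z), ∀ (Z' : Scheme.{0}) (τ' : Z' ⟶ Z),
          IsBlowup τ' (vanishingIdeal ⟨{z}, hz⟩) → ∀ z' : Z', τ' z' = z → IsRegularLocalRing (Z'.presheaf.stalk z') := by
  classical
  intro hy Z τ hτ
  -- the marks as maximal ideals
  let M : Fin (N + 1) → Finset (Ideal (MvPolynomial (Fin (N + 1)) K)) := fun a =>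
    (Λ a).image (fun lam => Ideal.span (Set.range fun i : Fin (N + 1) => (X i - C (lam i) : MvPolynomial (Fin (N + 1)) K)))
  have hM : ∀ a, ∀ 𝔪 ∈ M a, 𝔪.IsMaximal := by
    intro a 𝔪 h𝔪
    obtain ⟨lam, -, rfl⟩ := Finset.mem_image.mp h𝔪
    exact isMaximal_span_range_X_sub_C K lam
  have hjacM : ∀ a, ∀ P : Ideal (MvPolynomial (Fin (N + 1)) K), P.IsPrime → (X a : MvPolynomial (Fin (N + 1)) K) ∈ P → G a ∈ P →
      (∃ j, pderiv j (G a) ∉ P) ∨ ∃ 𝔪 ∈ M a, 𝔪 ≤ P := by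
    intro a P hP haP hGP
    rcases hjac a P hP haP hGP with h | ⟨lam, hlam, hP'⟩
    · exact Or.inl h
    · exact Or.inr ⟨_, Finset.mem_image.mpr ⟨lam, hlam, rfl⟩, Ideal.span_le.mpr (Set.range_subset_iff.mpr fun i => hP' i)⟩
  -- the dictionary `vanishingIdeal {y₀} = ofIdealTop (ȳ)`
  have hmax := isMaximal_map_mk_span_range_X K Φ Ψ hμ hΦ hΨ
  have hrad : (Ideal.map (Ideal.Quotient.mk (Ideal.span {Φ + Ψ}))
      (Ideal.span (Set.range (X : Fin (N + 1) → MvPolynomial (Fin (N + 1)) K)))).IsRadical := hmax.isPrime.isRadical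
  have hsing : ({y₀} : Set (Spec (CommRingCat.of (MvPolynomial (Fin (N + 1)) K ⧸ Ideal.span {Φ + Ψ})))) =
      PrimeSpectrum.zeroLocus ((Ideal.map (Ideal.Quotient.mk (Ideal.span {Φ + Ψ}))
        (Ideal.span (Set.range (X : Fin (N + 1) → MvPolynomial (Fin (N + 1)) K))) : Set _)) := by
    rw [← hy₀]
    exact singleton_eq_zeroLocus_of_isMaximal y₀ (hy₀ ▸ hmax)
  have hC : (⟨{y₀}, hy⟩ : Closeds (Spec (CommRingCat.of (MvPolynomial (Fin (N + 1)) K ⧸ Ideal.span {Φ + Ψ})))) =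
      ⟨PrimeSpectrum.zeroLocus ((Ideal.map (Ideal.Quotient.mk (Ideal.span {Φ + Ψ}))
        (Ideal.span (Set.range (X : Fin (N + 1) → MvPolynomial (Fin (N + 1)) K))) : Set _)), PrimeSpectrum.isClosed_zeroLocus _⟩ :=
    Closeds.ext hsing
  have hV : vanishingIdeal (⟨{y₀}, hy⟩ : Closeds (Spec (CommRingCat.of (MvPolynomial (Fin (N + 1)) K ⧸ Ideal.span {Φ + Ψ})))) = (ofIdealTop (Ideal.map (Scheme.ΓSpecIso (CommRingCat.of (MvPolynomial (Fin (N + 1)) K ⧸ Ideal.span {Φ + Ψ}))).inv.hom (Ideal.map (Ideal.Quotient.mk (Ideal.span {Φ + Ψ})) (Ideal.span (Set.range (X : Fin (N + 1) → MvPolynomial (Fin (N + 1)) K)))))) := by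
    rw [hC]
    exact vanishingIdeal_zeroLocus_eq_ofIdealTop_of_isRadical _ hrad
  have hsupp : ∀ z : Z, τ z = y₀ ↔ τ z ∈ ((ofIdealTop (Ideal.map (Scheme.ΓSpecIso (CommRingCat.of (MvPolynomial (Fin (N + 1)) K ⧸ Ideal.span {Φ + Ψ}))).inv.hom (Ideal.map (Ideal.Quotient.mk (Ideal.span {Φ + Ψ})) (Ideal.span (Set.range (X : Fin (N + 1) → MvPolynomial (Fin (N + 1)) K)))))).support : Set (Spec (CommRingCat.of (MvPolynomial (Fin (N + 1)) K ⧸ Ideal.span {Φ + Ψ})))) := by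
    intro z
    rw [← hV, Scheme.IdealSheafData.coe_support_vanishingIdeal]
    exact Iff.rfl
  have hτ' := hτ
  rw [hV] at hτ'
  haveI : IsProper τ := hτ.isProper
  -- the finite set of non-regular points over the origin
  obtain ⟨S', hS'⟩ := (finite_setOf_not_isRegularLocalRing_marked K Φ Ψ hΦ hΦ0 hΨ G hG M hM hjacM hτ').exists_finset_coe
  refine ⟨S', fun z hz hzS => ?_, fun z hzS => ?_⟩
  · by_contra hreg
    apply hzS
    rw [← Finset.mem_coe, hS']
    exact ⟨(hsupp z).mp hz, hreg⟩
  · have hzS' : z ∈ (S' : Set Z) := Finset.mem_coe.mpr hzS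
    rw [hS'] at hzS'
    obtain ⟨hzs, hzreg⟩ := hzS'
    refine ⟨(hsupp z).mpr hzs, ?_⟩
    obtain ⟨a, χ, φ, hφ, 𝔪, w, h𝔪M, hχa, hφρ, hw, hφw⟩ :=
      exists_chart_marked_of_not_isRegularLocalRing K Φ Ψ hΦ hΦ0 hΨ G hG M hM hjacM hτ' z hzs hzreg
    obtain ⟨lam, hlam, h𝔪eq⟩ := Finset.mem_image.mp h𝔪M
    -- the mark lies on the strict transform
    have hGa : G a ∈ Ideal.span (Set.range fun i : Fin (N + 1) => (X i - C (lam i) : MvPolynomial (Fin (N + 1)) K)) := by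
      rw [h𝔪eq]
      exact mem_of_mark_ne_top K (G a) 𝔪 (hM a 𝔪 h𝔪M) χ w.asIdeal w.isPrime.ne_top hw
    obtain ⟨μ', Φ', Ψ', hμ', hΦ', hΦ'0, hΨ', hGeq, hone'⟩ := hsec a lam hlam hGa
    rw [← hφw]
    rw [← h𝔪eq] at hw
    exact oneStepAt_chartMark K Φ Ψ a (G a) lam Φ' Ψ' hμ' hΦ' hΦ'0 hΨ' hGeq hone' χ τ φ w hw

end OneStep

end Summit.ResolutionOfSingularities.ResolutionOfSingularities.Cruxes.EquisingularLiftNat.Sections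

end
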